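import Mathlib
import Literature.MathematicalPhysics.QuantumLattice.PairCorrelations

/-!
# Crux `InfraredCompletion` (stmt-HubbardSuperconductivity-1321, route BcsKacWindow):
# the typed transfer is the window ⇒ bulk transfer FOR EVERY RATE at which the window opens

The hypothesis of the crux (verbatim the body of `CoherenceWindowLRO`) is RATE-FREE:
`∀ s ≥ s₀, ∃ U₁(s) > 0, ∀ U ∈ (0, U₁(s))`, order `≥ c₀Δ(U)²` on all even tori with
`s₀ ≤ Δ(U)·L ≤ s`. Equivalently (this file, pure bookkeeping) there is a WINDOW-TOP function
`S : ℝ → ℝ` with `S(U) → +∞` as `U → 0⁺` such that for all small `U` the bound holds on every even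
torus with `s₀ ≤ Δ(U)·L ≤ S(U)`; but the hypothesis says nothing about HOW FAST `S(U)` diverges.

* `exists_rate_of_window` — from the rate-free window hypothesis (abstract predicate `P s U`,
  no monotonicity needed) a window-top function `S ≥ s₀` diverging at `0⁺` with the rated window
  `∃ U⋆ > 0, ∀ U ∈ (0,U⋆), P (S U) U` (construction: `S(U) = s₀ + max{n ≤ 1/U : U < U₁(s₀+k), k ≤ n}`);
* `window_of_rate` — conversely a rated window with ANY divergent `S` gives back the rate-free
  window when `P` is antitone in the window top;
* `ratedTransfer_of_infraredCompletion` — hence the crux AS TYPED implies, for EVERY divergent rate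
  `S`, the `S`-rated transfer "rated window ⇒ bulk order";
* `infraredCompletion_of_forall_ratedTransfer`, `infraredCompletion_iff_forall_ratedTransfer` — and
  the crux is EQUIVALENT to the conjunction of the rated transfers over all divergent rates.

Reading for the route (lead c16, 2026-08-17): a proof of the typed crux must work for windows that
open ARBITRARILY SLOWLY in `U`, so it can use no engine whose constants degrade as `U → 0⁺`
(however mildly) — every constant fed into the zero-mode bootstrap of line `birth`
(`BcsKacWindowInfraredCompletionSqrtShape.lean`: `t ≥ 64A²/c_A + 16D/c_A + 8B/c_A`, `t` fixed
before `U`) must be `U`-uniform. The amplitude-softness barrier recorded by lead c15 (moment-method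
background `B(U) ~ U⁻¹`) is one instance. The `S`-rated transfer for ONE explicit rate `S` (the one a
proof of `CoherenceWindowLRO` would deliver) is the strictly weaker statement the route actually
consumes (`TargetOfWindow` uses the transfer only at the datum produced by `CoherenceWindowLRO`).
No physics is used. [folklore: bookkeeping on quantifiers; cf. Kennedy–Lieb–Shastry,
PRL 61 (1988) 2582 for the finite-size-criterion framing]
-/

noncomputable section

-- the mandated namespace `Summit.<Summit>.<Problem>.Theorems…` repeats `HubbardSuperconductivity`
-- (single-problem summit, D-0017), which the `dupNamespace` linter flags on every declaration
set_option linter.dupNamespace false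

namespace Summit.HubbardSuperconductivity.HubbardSuperconductivity.Theorems.InfraredCompletion

open Literature.MathematicalPhysics.QuantumLattice Literature.Probability.LatticeModels
open scoped Matrix Classical

/-! ### Abstract bookkeeping: rate-free window ↔ rated window with a divergent top -/

/-- A finite family of positive reals has a positive common lower bound:
for `u : ℕ → ℝ` with `u n > 0` and any `m`, some `w > 0` satisfies `w ≤ u k` for all `k ≤ m`.
[folklore] -/
theorem exists_pos_le_forall_le (u : ℕ → ℝ) (hu : ∀ n, 0 < u n) (m : ℕ) :
    ∃ w : ℝ, 0 < w ∧ ∀ k, k ≤ m → w ≤ u k := by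
  induction m with
  | zero => exact ⟨u 0, hu 0, fun k hk => by rw [Nat.le_zero.1 hk]⟩
  | succ m ih =>
    obtain ⟨w, hw, h⟩ := ih
    refine ⟨min w (u (m + 1)), lt_min hw (hu _), fun k hk => ?_⟩
    rcases Nat.le_succ_iff.1 hk with hk' | rfl
    · exact (min_le_left _ _).trans (h k hk')
    · exact min_le_right _ _

/-- **From a rate-free window to a rated window.** Let `P s U` be any predicate ("the window bound
holds up to window top `s` at coupling `U`"). If for every top `s ≥ s₀` there is `U₁(s) > 0` with
`P s U` for all `U ∈ (0, U₁(s))`, then there is a window-top function `S : ℝ → ℝ`, `S ≥ s₀`,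
DIVERGING at `0⁺` (`∀ M, ∃ U₂ > 0, ∀ U ∈ (0,U₂), M ≤ S U`), and `U⋆ > 0` such that `P (S U) U`
holds for all `U ∈ (0, U⋆)`. Construction: with `uₙ = U₁(s₀ + n)`,
`S(U) = s₀ + max{n : n ≤ 1/U, U < u_k for all k ≤ n}` and `U⋆ = u₀`. No monotonicity of `P` is
needed. [folklore] -/
theorem exists_rate_of_window {P : ℝ → ℝ → Prop} {s₀ : ℝ}
    (hW : ∀ s : ℝ, s₀ ≤ s → ∃ U₁ : ℝ, 0 < U₁ ∧ ∀ U ∈ Set.Ioo (0:ℝ) U₁, P s U) :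
    ∃ S : ℝ → ℝ, (∀ M : ℝ, ∃ U₂ : ℝ, 0 < U₂ ∧ ∀ U ∈ Set.Ioo (0:ℝ) U₂, M ≤ S U) ∧
      (∀ U : ℝ, s₀ ≤ S U) ∧ ∃ Us : ℝ, 0 < Us ∧ ∀ U ∈ Set.Ioo (0:ℝ) Us, P (S U) U := by
  -- window tops `s₀ + n`, `n : ℕ`
  have hWn : ∀ n : ℕ, ∃ U₁ : ℝ, 0 < U₁ ∧ ∀ U ∈ Set.Ioo (0:ℝ) U₁, P (s₀ + n) U := fun n =>
    hW (s₀ + n) (le_add_of_nonneg_right (Nat.cast_nonneg n))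
  choose u hu_pos hu using hWn
  -- admissible tops at coupling `U`: `n ≤ 1/U` with `U` below `u 0, …, u n`
  let A : ℝ → Finset ℕ := fun U =>
    (Finset.range (⌊1 / U⌋₊ + 1)).filter (fun n => ∀ k, k ≤ n → U < u k)
  let N : ℝ → ℕ := fun U => (A U).sup id
  refine ⟨fun U => s₀ + (N U : ℝ), ?_, fun U => le_add_of_nonneg_right (Nat.cast_nonneg _),
    u 0, hu_pos 0, ?_⟩
  · -- divergence at `0⁺`
    intro M
    obtain ⟨w, hw, hwu⟩ := exists_pos_le_forall_le u hu_pos ⌈M - s₀⌉₊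
    refine ⟨min w (1 / ((⌈M - s₀⌉₊ : ℝ) + 1)), lt_min hw (by positivity), fun U hU => ?_⟩
    obtain ⟨hU0, hU1⟩ := hU
    have hUw : U < w := lt_of_lt_of_le hU1 (min_le_left _ _)
    have hUm : U < 1 / ((⌈M - s₀⌉₊ : ℝ) + 1) := lt_of_lt_of_le hU1 (min_le_right _ _)
    have h1 : U * ((⌈M - s₀⌉₊ : ℝ) + 1) < 1 := (lt_div_iff₀ (by positivity)).1 hUm
    have hmem : ⌈M - s₀⌉₊ ∈ A U := by
      rw [Finset.mem_filter, Finset.mem_range, Nat.lt_add_one_iff,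
        Nat.le_floor_iff (le_of_lt (one_div_pos.2 hU0)), le_div_iff₀ hU0]
      refine ⟨?_, fun k hk => lt_of_lt_of_le hUw (hwu k hk)⟩
      calc (⌈M - s₀⌉₊ : ℝ) * U ≤ (⌈M - s₀⌉₊ : ℝ) * U + U := le_add_of_nonneg_right hU0.le
        _ = U * ((⌈M - s₀⌉₊ : ℝ) + 1) := by ring
        _ ≤ 1 := h1.le
    have hle : ⌈M - s₀⌉₊ ≤ N U := Finset.le_sup (f := id) hmem
    show M ≤ s₀ + (N U : ℝ)
    calc M = s₀ + (M - s₀) := by ring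
      _ ≤ s₀ + (⌈M - s₀⌉₊ : ℝ) := add_le_add le_rfl (Nat.le_ceil _)
      _ ≤ s₀ + (N U : ℝ) :=
        add_le_add le_rfl (show ((⌈M - s₀⌉₊ : ℕ) : ℝ) ≤ ((N U : ℕ) : ℝ) by exact_mod_cast hle)
  · -- the rated window below `u 0`
    intro U hU
    obtain ⟨hU0, hU1⟩ := hU
    have h0 : (0 : ℕ) ∈ A U := by
      rw [Finset.mem_filter, Finset.mem_range]
      exact ⟨Nat.succ_pos _, fun k hk => by rw [Nat.le_zero.1 hk]; exact hU1⟩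
    obtain ⟨n, hn, hNn⟩ := Finset.exists_mem_eq_sup (A U) ⟨0, h0⟩ id
    have hn' : ∀ k, k ≤ n → U < u k := (Finset.mem_filter.1 hn).2
    have hP : P (s₀ + n) U := hu n U ⟨hU0, hn' n le_rfl⟩
    show P (s₀ + ((A U).sup id : ℕ)) U
    rw [hNn]
    exact hP

/-- **From a rated window back to the rate-free window.** If `P` is antitone in the window top
(`s ≤ s'` and `P s' U` give `P s U`), a rated window `∃ U⋆ > 0, ∀ U ∈ (0,U⋆), P (S U) U` with a
top `S` diverging at `0⁺` yields, for every top `s`, some `U₁ > 0` with `P s U` on `(0, U₁)`.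
[folklore] -/
theorem window_of_rate {P : ℝ → ℝ → Prop} (hP : ∀ s s' U, s ≤ s' → P s' U → P s U)
    {S : ℝ → ℝ} (hS : ∀ M : ℝ, ∃ U₂ : ℝ, 0 < U₂ ∧ ∀ U ∈ Set.Ioo (0:ℝ) U₂, M ≤ S U)
    (hWS : ∃ Us : ℝ, 0 < Us ∧ ∀ U ∈ Set.Ioo (0:ℝ) Us, P (S U) U) (s : ℝ) :
    ∃ U₁ : ℝ, 0 < U₁ ∧ ∀ U ∈ Set.Ioo (0:ℝ) U₁, P s U := by
  obtain ⟨Us, hUs, h⟩ := hWS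
  obtain ⟨U₂, hU₂, h₂⟩ := hS s
  refine ⟨min Us U₂, lt_min hUs hU₂, fun U hU => ?_⟩
  have hU1 : U ∈ Set.Ioo (0:ℝ) Us := ⟨hU.1, lt_of_lt_of_le hU.2 (min_le_left _ _)⟩
  have hU2 : U ∈ Set.Ioo (0:ℝ) U₂ := ⟨hU.1, lt_of_lt_of_le hU.2 (min_le_right _ _)⟩
  exact hP s (S U) U (h₂ U hU2) (h U hU1)

/-! ### The crux and its rated forms -/

/-- **The typed crux implies every rated transfer.** For EVERY window-top function `S` diverging
at `0⁺`, the crux `InfraredCompletion` (body verbatim, inlined: this module does not import the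
route file) implies the `S`-rated transfer: same datum `(a,b,κ₁,κ₂,c₀,s₀,Δ)`, same flat pin,
hypothesis "for some `U⋆ > 0` and all `δ ∈ [a,b]`, `U ∈ (0,U⋆)`, every even torus with
`s₀ ≤ Δ(U)·L ≤ S(U)` and every normalised sector ground state has order `≥ c₀Δ(U)²`", same bulk
conclusion. In particular the typed crux must hold for windows opening ARBITRARILY SLOWLY, so no
`U`-dependent engine constant can enter its proof (`window_of_rate`). [folklore] -/
theorem ratedTransfer_of_infraredCompletion
    (hI : ∀ (a b κ₁ κ₂ c₀ s₀ : ℝ) (Δ : ℝ → ℝ), 0 < a → a < b → b < 1 / 2 → 0 < κ₁ → κ₁ ≤ κ₂ →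
      0 < c₀ → 0 < s₀ →
      (∀ U : ℝ, 0 < U → Real.exp (-(κ₂ / U ^ 2)) ≤ Δ U ∧ Δ U ≤ Real.exp (-(κ₁ / U ^ 2))) →
      (∀ s : ℝ, s₀ ≤ s → ∃ U₁ : ℝ, 0 < U₁ ∧ ∀ δ ∈ Set.Icc a b, ∀ U ∈ Set.Ioo (0:ℝ) U₁,
        ∀ (L : ℕ) [NeZero L], Even L → s₀ ≤ Δ U * L → Δ U * L ≤ s →
          ∀ ψ : Fock (Orb (FermionTorus 2 L)), star ψ ⬝ᵥ ψ = 1 →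
            IsGroundStateInSector (hubbardTorus 2 L 1 U) (2 * ⌊(1 - δ) * (L : ℝ) ^ 2 / 2⌋₊) 0 ψ →
              c₀ * Δ U ^ 2 ≤ (expect ((pairField dWaveFormFactor L)ᴴ * pairField dWaveFormFactor L)
                ψ).re / (L : ℝ) ^ 4) →
      ∃ c₁ s₁ U₁ : ℝ, 0 < c₁ ∧ 0 < U₁ ∧ ∀ δ ∈ Set.Icc a b, ∀ U ∈ Set.Ioo (0:ℝ) U₁,
        ∀ (L : ℕ) [NeZero L], Even L → s₁ ≤ Δ U * L →
          ∀ ψ : Fock (Orb (FermionTorus 2 L)), star ψ ⬝ᵥ ψ = 1 →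
            IsGroundStateInSector (hubbardTorus 2 L 1 U) (2 * ⌊(1 - δ) * (L : ℝ) ^ 2 / 2⌋₊) 0 ψ →
              c₁ * Δ U ^ 2 ≤ (expect ((pairField dWaveFormFactor L)ᴴ * pairField dWaveFormFactor L)
                ψ).re / (L : ℝ) ^ 4)
    (S : ℝ → ℝ) (hS : ∀ M : ℝ, ∃ U₂ : ℝ, 0 < U₂ ∧ ∀ U ∈ Set.Ioo (0:ℝ) U₂, M ≤ S U) :
    ∀ (a b κ₁ κ₂ c₀ s₀ : ℝ) (Δ : ℝ → ℝ), 0 < a → a < b → b < 1 / 2 → 0 < κ₁ → κ₁ ≤ κ₂ →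
      0 < c₀ → 0 < s₀ →
      (∀ U : ℝ, 0 < U → Real.exp (-(κ₂ / U ^ 2)) ≤ Δ U ∧ Δ U ≤ Real.exp (-(κ₁ / U ^ 2))) →
      (∃ Us : ℝ, 0 < Us ∧ ∀ δ ∈ Set.Icc a b, ∀ U ∈ Set.Ioo (0:ℝ) Us,
        ∀ (L : ℕ) [NeZero L], Even L → s₀ ≤ Δ U * L → Δ U * L ≤ S U →
          ∀ ψ : Fock (Orb (FermionTorus 2 L)), star ψ ⬝ᵥ ψ = 1 →
            IsGroundStateInSector (hubbardTorus 2 L 1 U) (2 * ⌊(1 - δ) * (L : ℝ) ^ 2 / 2⌋₊) 0 ψ →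
              c₀ * Δ U ^ 2 ≤ (expect ((pairField dWaveFormFactor L)ᴴ * pairField dWaveFormFactor L)
                ψ).re / (L : ℝ) ^ 4) →
      ∃ c₁ s₁ U₁ : ℝ, 0 < c₁ ∧ 0 < U₁ ∧ ∀ δ ∈ Set.Icc a b, ∀ U ∈ Set.Ioo (0:ℝ) U₁,
        ∀ (L : ℕ) [NeZero L], Even L → s₁ ≤ Δ U * L →
          ∀ ψ : Fock (Orb (FermionTorus 2 L)), star ψ ⬝ᵥ ψ = 1 →
            IsGroundStateInSector (hubbardTorus 2 L 1 U) (2 * ⌊(1 - δ) * (L : ℝ) ^ 2 / 2⌋₊) 0 ψ →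
              c₁ * Δ U ^ 2 ≤ (expect ((pairField dWaveFormFactor L)ᴴ * pairField dWaveFormFactor L)
                ψ).re / (L : ℝ) ^ 4 := by
  intro a b κ₁ κ₂ c₀ s₀ Δ ha hab hb hκ₁ hκ hc₀ hs₀ hpin hWS
  refine hI a b κ₁ κ₂ c₀ s₀ Δ ha hab hb hκ₁ hκ hc₀ hs₀ hpin ?_
  intro s _
  obtain ⟨Us, hUs, h⟩ := hWS
  have key := window_of_rate
    (P := fun s U => ∀ δ ∈ Set.Icc a b, ∀ (L : ℕ) [NeZero L], Even L → s₀ ≤ Δ U * L →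
      Δ U * L ≤ s → ∀ ψ : Fock (Orb (FermionTorus 2 L)), star ψ ⬝ᵥ ψ = 1 →
        IsGroundStateInSector (hubbardTorus 2 L 1 U) (2 * ⌊(1 - δ) * (L : ℝ) ^ 2 / 2⌋₊) 0 ψ →
          c₀ * Δ U ^ 2 ≤ (expect ((pairField dWaveFormFactor L)ᴴ * pairField dWaveFormFactor L)
            ψ).re / (L : ℝ) ^ 4)
    (fun s s' U hss' h' δ hδ L _ hL h0 hs ψ hψ hGS => h' δ hδ L hL h0 (hs.trans hss') ψ hψ hGS)
    hS ⟨Us, hUs, fun U hU δ hδ => h δ hδ U hU⟩ s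
  obtain ⟨U₁, hU₁, h₁⟩ := key
  exact ⟨U₁, hU₁, fun δ hδ U hU => h₁ U hU δ hδ⟩

/-- **The rated transfers for all divergent rates imply the typed crux.** If for EVERY window-top
function `S` diverging at `0⁺` the `S`-rated transfer holds, then `InfraredCompletion` (body
verbatim) holds: a rate-free window IS a rated window for the top function built in
`exists_rate_of_window`. [folklore] -/
theorem infraredCompletion_of_forall_ratedTransfer
    (hR : ∀ S : ℝ → ℝ, (∀ M : ℝ, ∃ U₂ : ℝ, 0 < U₂ ∧ ∀ U ∈ Set.Ioo (0:ℝ) U₂, M ≤ S U) →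
      ∀ (a b κ₁ κ₂ c₀ s₀ : ℝ) (Δ : ℝ → ℝ), 0 < a → a < b → b < 1 / 2 → 0 < κ₁ → κ₁ ≤ κ₂ →
      0 < c₀ → 0 < s₀ →
      (∀ U : ℝ, 0 < U → Real.exp (-(κ₂ / U ^ 2)) ≤ Δ U ∧ Δ U ≤ Real.exp (-(κ₁ / U ^ 2))) →
      (∃ Us : ℝ, 0 < Us ∧ ∀ δ ∈ Set.Icc a b, ∀ U ∈ Set.Ioo (0:ℝ) Us,
        ∀ (L : ℕ) [NeZero L], Even L → s₀ ≤ Δ U * L → Δ U * L ≤ S U →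
          ∀ ψ : Fock (Orb (FermionTorus 2 L)), star ψ ⬝ᵥ ψ = 1 →
            IsGroundStateInSector (hubbardTorus 2 L 1 U) (2 * ⌊(1 - δ) * (L : ℝ) ^ 2 / 2⌋₊) 0 ψ →
              c₀ * Δ U ^ 2 ≤ (expect ((pairField dWaveFormFactor L)ᴴ * pairField dWaveFormFactor L)
                ψ).re / (L : ℝ) ^ 4) →
      ∃ c₁ s₁ U₁ : ℝ, 0 < c₁ ∧ 0 < U₁ ∧ ∀ δ ∈ Set.Icc a b, ∀ U ∈ Set.Ioo (0:ℝ) U₁,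
        ∀ (L : ℕ) [NeZero L], Even L → s₁ ≤ Δ U * L →
          ∀ ψ : Fock (Orb (FermionTorus 2 L)), star ψ ⬝ᵥ ψ = 1 →
            IsGroundStateInSector (hubbardTorus 2 L 1 U) (2 * ⌊(1 - δ) * (L : ℝ) ^ 2 / 2⌋₊) 0 ψ →
              c₁ * Δ U ^ 2 ≤ (expect ((pairField dWaveFormFactor L)ᴴ * pairField dWaveFormFactor L)
                ψ).re / (L : ℝ) ^ 4) :
    ∀ (a b κ₁ κ₂ c₀ s₀ : ℝ) (Δ : ℝ → ℝ), 0 < a → a < b → b < 1 / 2 → 0 < κ₁ → κ₁ ≤ κ₂ →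
      0 < c₀ → 0 < s₀ →
      (∀ U : ℝ, 0 < U → Real.exp (-(κ₂ / U ^ 2)) ≤ Δ U ∧ Δ U ≤ Real.exp (-(κ₁ / U ^ 2))) →
      (∀ s : ℝ, s₀ ≤ s → ∃ U₁ : ℝ, 0 < U₁ ∧ ∀ δ ∈ Set.Icc a b, ∀ U ∈ Set.Ioo (0:ℝ) U₁,
        ∀ (L : ℕ) [NeZero L], Even L → s₀ ≤ Δ U * L → Δ U * L ≤ s →
          ∀ ψ : Fock (Orb (FermionTorus 2 L)), star ψ ⬝ᵥ ψ = 1 →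
            IsGroundStateInSector (hubbardTorus 2 L 1 U) (2 * ⌊(1 - δ) * (L : ℝ) ^ 2 / 2⌋₊) 0 ψ →
              c₀ * Δ U ^ 2 ≤ (expect ((pairField dWaveFormFactor L)ᴴ * pairField dWaveFormFactor L)
                ψ).re / (L : ℝ) ^ 4) →
      ∃ c₁ s₁ U₁ : ℝ, 0 < c₁ ∧ 0 < U₁ ∧ ∀ δ ∈ Set.Icc a b, ∀ U ∈ Set.Ioo (0:ℝ) U₁,
        ∀ (L : ℕ) [NeZero L], Even L → s₁ ≤ Δ U * L →
          ∀ ψ : Fock (Orb (FermionTorus 2 L)), star ψ ⬝ᵥ ψ = 1 →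
            IsGroundStateInSector (hubbardTorus 2 L 1 U) (2 * ⌊(1 - δ) * (L : ℝ) ^ 2 / 2⌋₊) 0 ψ →
              c₁ * Δ U ^ 2 ≤ (expect ((pairField dWaveFormFactor L)ᴴ * pairField dWaveFormFactor L)
                ψ).re / (L : ℝ) ^ 4 := by
  intro a b κ₁ κ₂ c₀ s₀ Δ ha hab hb hκ₁ hκ hc₀ hs₀ hpin hW
  have hW' : ∀ s : ℝ, s₀ ≤ s → ∃ U₁ : ℝ, 0 < U₁ ∧ ∀ U ∈ Set.Ioo (0:ℝ) U₁,
      (fun s U => ∀ δ ∈ Set.Icc a b, ∀ (L : ℕ) [NeZero L], Even L → s₀ ≤ Δ U * L →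
        Δ U * L ≤ s → ∀ ψ : Fock (Orb (FermionTorus 2 L)), star ψ ⬝ᵥ ψ = 1 →
          IsGroundStateInSector (hubbardTorus 2 L 1 U) (2 * ⌊(1 - δ) * (L : ℝ) ^ 2 / 2⌋₊) 0 ψ →
            c₀ * Δ U ^ 2 ≤ (expect ((pairField dWaveFormFactor L)ᴴ * pairField dWaveFormFactor L)
              ψ).re / (L : ℝ) ^ 4) s U := by
    intro s hs
    obtain ⟨U₁, hU₁, h₁⟩ := hW s hs
    exact ⟨U₁, hU₁, fun U hU δ hδ => h₁ δ hδ U hU⟩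
  obtain ⟨S, hdiv, -, Us, hUs, hWS⟩ := exists_rate_of_window hW'
  exact hR S hdiv a b κ₁ κ₂ c₀ s₀ Δ ha hab hb hκ₁ hκ hc₀ hs₀ hpin
    ⟨Us, hUs, fun δ hδ U hU => hWS U hU δ hδ⟩

/-- **Characterisation.** The crux `InfraredCompletion` (body verbatim) is EQUIVALENT to the
conjunction, over ALL window-top functions `S` diverging at `0⁺`, of the `S`-rated transfers
"rated window ⇒ bulk order". The route consumes the transfer only at the datum (and hence the
rate) that a proof of `CoherenceWindowLRO` would supply; the typed crux asserts it for every
rate, including arbitrarily slow ones. [folklore] -/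
theorem infraredCompletion_iff_forall_ratedTransfer :
    (∀ (a b κ₁ κ₂ c₀ s₀ : ℝ) (Δ : ℝ → ℝ), 0 < a → a < b → b < 1 / 2 → 0 < κ₁ → κ₁ ≤ κ₂ →
      0 < c₀ → 0 < s₀ →
      (∀ U : ℝ, 0 < U → Real.exp (-(κ₂ / U ^ 2)) ≤ Δ U ∧ Δ U ≤ Real.exp (-(κ₁ / U ^ 2))) →
      (∀ s : ℝ, s₀ ≤ s → ∃ U₁ : ℝ, 0 < U₁ ∧ ∀ δ ∈ Set.Icc a b, ∀ U ∈ Set.Ioo (0:ℝ) U₁,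
        ∀ (L : ℕ) [NeZero L], Even L → s₀ ≤ Δ U * L → Δ U * L ≤ s →
          ∀ ψ : Fock (Orb (FermionTorus 2 L)), star ψ ⬝ᵥ ψ = 1 →
            IsGroundStateInSector (hubbardTorus 2 L 1 U) (2 * ⌊(1 - δ) * (L : ℝ) ^ 2 / 2⌋₊) 0 ψ →
              c₀ * Δ U ^ 2 ≤ (expect ((pairField dWaveFormFactor L)ᴴ * pairField dWaveFormFactor L)
                ψ).re / (L : ℝ) ^ 4) →
      ∃ c₁ s₁ U₁ : ℝ, 0 < c₁ ∧ 0 < U₁ ∧ ∀ δ ∈ Set.Icc a b, ∀ U ∈ Set.Ioo (0:ℝ) U₁,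
        ∀ (L : ℕ) [NeZero L], Even L → s₁ ≤ Δ U * L →
          ∀ ψ : Fock (Orb (FermionTorus 2 L)), star ψ ⬝ᵥ ψ = 1 →
            IsGroundStateInSector (hubbardTorus 2 L 1 U) (2 * ⌊(1 - δ) * (L : ℝ) ^ 2 / 2⌋₊) 0 ψ →
              c₁ * Δ U ^ 2 ≤ (expect ((pairField dWaveFormFactor L)ᴴ * pairField dWaveFormFactor L)
                ψ).re / (L : ℝ) ^ 4) ↔
    (∀ S : ℝ → ℝ, (∀ M : ℝ, ∃ U₂ : ℝ, 0 < U₂ ∧ ∀ U ∈ Set.Ioo (0:ℝ) U₂, M ≤ S U) →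
      ∀ (a b κ₁ κ₂ c₀ s₀ : ℝ) (Δ : ℝ → ℝ), 0 < a → a < b → b < 1 / 2 → 0 < κ₁ → κ₁ ≤ κ₂ →
      0 < c₀ → 0 < s₀ →
      (∀ U : ℝ, 0 < U → Real.exp (-(κ₂ / U ^ 2)) ≤ Δ U ∧ Δ U ≤ Real.exp (-(κ₁ / U ^ 2))) →
      (∃ Us : ℝ, 0 < Us ∧ ∀ δ ∈ Set.Icc a b, ∀ U ∈ Set.Ioo (0:ℝ) Us,
        ∀ (L : ℕ) [NeZero L], Even L → s₀ ≤ Δ U * L → Δ U * L ≤ S U →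
          ∀ ψ : Fock (Orb (FermionTorus 2 L)), star ψ ⬝ᵥ ψ = 1 →
            IsGroundStateInSector (hubbardTorus 2 L 1 U) (2 * ⌊(1 - δ) * (L : ℝ) ^ 2 / 2⌋₊) 0 ψ →
              c₀ * Δ U ^ 2 ≤ (expect ((pairField dWaveFormFactor L)ᴴ * pairField dWaveFormFactor L)
                ψ).re / (L : ℝ) ^ 4) →
      ∃ c₁ s₁ U₁ : ℝ, 0 < c₁ ∧ 0 < U₁ ∧ ∀ δ ∈ Set.Icc a b, ∀ U ∈ Set.Ioo (0:ℝ) U₁,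
        ∀ (L : ℕ) [NeZero L], Even L → s₁ ≤ Δ U * L →
          ∀ ψ : Fock (Orb (FermionTorus 2 L)), star ψ ⬝ᵥ ψ = 1 →
            IsGroundStateInSector (hubbardTorus 2 L 1 U) (2 * ⌊(1 - δ) * (L : ℝ) ^ 2 / 2⌋₊) 0 ψ →
              c₁ * Δ U ^ 2 ≤ (expect ((pairField dWaveFormFactor L)ᴴ * pairField dWaveFormFactor L)
                ψ).re / (L : ℝ) ^ 4) :=
  ⟨fun hI S hS => ratedTransfer_of_infraredCompletion hI S hS,
    fun hR => infraredCompletion_of_forall_ratedTransfer hR⟩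

end Summit.HubbardSuperconductivity.HubbardSuperconductivity.Theorems.InfraredCompletion

end
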